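import Mathlib.Analysis.Quaternion
import Mathlib.Analysis.SpecialFunctions.Sqrt
import Mathlib.LinearAlgebra.Matrix.Determinant.Basic
import Mathlib.Topology.Covering.Quotient
import Mathlib.Topology.Homotopy.Lifting
import Mathlib.Topology.Instances.Matrix
import Mathlib.SetTheory.Cardinal.Finite
import Literature.AlgebraicTopology.FundamentalGroup.SphereSimplyConnected
import HarnessLib

/-!
# The rotation group `SO(3)`: the universal cover `S³ → SO(3)` and `π₁(SO(3)) = ℤ/2` — proved

Topic `Literature/AlgebraicTopology/FundamentalGroup`. Real proofs of the classical facts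
(Hatcher, *Algebraic Topology*, §3.D: "the homomorphism `S³ → SO(3)` … is surjective with kernel
`ℤ₂ = {±1}` … the universal cover `S³ → SO(3)`", together with `π₁(S³) = 0`, Prop. 1.14, and the
classification of coverings, Prop. 1.39/1.40: the fundamental group of the base of a simply
connected covering is the group of deck transformations):

* `Literature.AlgebraicTopology.FundamentalGroup.SO3` — the group `SO(3) = {M ∈ M₃(ℝ) | Mᵀ M = 1, det M = 1}` as a subtype of `M₃(ℝ)`
  (subspace topology, its own `Group` instance; see the docstring for why Mathlib's
  `Matrix.specialOrthogonalGroup` is not used);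
* `Literature.quatRot q` — the matrix of `v ↦ q v q̄` on `Im ℍ` in the basis `i, j, k`, for every
  quaternion `q` (a polynomial map), with `quatRot (p q) = quatRot p · quatRot q`,
  `(quatRot q)ᵀ quatRot q = |q|⁴ · 1`, `det quatRot q = |q|⁶` (**proved**, polynomial identities);
* `Literature.rotHom : S³ →* SO(3)` — the restriction to unit quaternions (`Metric.sphere (0 : ℍ) 1`,
  Mathlib's topological group structure), continuous, **surjective** (every rotation is a product
  of coordinate-axis rotations by Givens elimination of the first column, and coordinate-axis
  rotations are images of `cos(θ/2) + sin(θ/2)·axis` by the half-angle formulas) with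
  **kernel `{±1}`**;
* `Literature.AlgebraicTopology.FundamentalGroup.isQuotientCoveringMap_rotHom` — `S³ → SO(3)` is a (regular) covering map with group
  `{±1}` (Mathlib: a quotient group homomorphism with discrete kernel is a quotient covering map);
* `Literature.AlgebraicTopology.FundamentalGroup.SO3.card_fundamentalGroup` — **`π₁(SO(3), 1)` has exactly two elements** (Mathlib's
  `IsQuotientCoveringMap.fundamentalGroupEquiv : π₁(X) ≃* Gᵐᵒᵖ` for a simply connected total
  space, with `π₁(S³) = 0` from `SphereSimplyConnected.lean`).

Written for the discharge of `Literature.Topology.FourManifolds.fundamentalGroup_posDetMatrix_three` and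
`Literature.Topology.FourManifolds.gompf2010_framingLoop_essential` (`Literature/Topology/FourManifolds/GompfTheorem43.lean`:
`π₁(GL⁺(3, ℝ)) = ℤ/2` and the essential loop in the proof of Gompf's Theorem 4.3), via the
Gram–Schmidt retraction `GL⁺(3, ℝ) → SO(3)` (`PosDetMatrixFundamentalGroup.lean`).

## References

* A. Hatcher, *Algebraic Topology*, Cambridge University Press (2002), §1.1 Prop. 1.14,
  §1.3 (Prop. 1.39, deck transformations and `π₁`), §3.D (`SO(3) ≈ ℝP³`, the universal cover
  `S³ → SO(3)` with kernel `{±1}`). [HatcherAT2002]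
-/

noncomputable section

open Set Function Matrix Topology

namespace Literature.AlgebraicTopology.FundamentalGroup

/-! ### `SO(3)` -/

/-- **The rotation group `SO(3)`** as the subspace `{M | Mᵀ M = 1 ∧ det M = 1}` of `M₃(ℝ)`, with
its group structure (`M⁻¹ = Mᵀ`). (Mathlib's `Matrix.specialOrthogonalGroup n ℝ` is the same
set as a `Submonoid` defined through the unitary group for the `star` of `starRingOfComm`, a local
instance; a plain subtype with an explicit `Group` instance avoids carrying that local instance
through topology.) [cite: HatcherAT2002, §3.D (the groups SO(n))] -/
abbrev SO3 : Type := {M : Matrix (Fin 3) (Fin 3) ℝ // Mᵀ * M = 1 ∧ M.det = 1}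

namespace SO3

/-- `M Mᵀ = 1` as well. [folklore] -/
theorem mul_transpose_self (A : SO3) : A.1 * A.1ᵀ = 1 := mul_eq_one_comm.1 A.2.1

/-- The group structure of `SO(3)`: matrix product, inverse = transpose. [cite: HatcherAT2002, §3.D (the groups SO(n))] -/
instance : Group SO3 where
  mul A B := ⟨A.1 * B.1, by
    rw [Matrix.transpose_mul, Matrix.mul_assoc, ← Matrix.mul_assoc A.1ᵀ, A.2.1, Matrix.one_mul,
      B.2.1], by rw [Matrix.det_mul, A.2.2, B.2.2, mul_one]⟩
  one := ⟨1, by simp, by simp⟩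
  inv A := ⟨A.1ᵀ, by rw [Matrix.transpose_transpose]; exact A.mul_transpose_self,
    by rw [Matrix.det_transpose, A.2.2]⟩
  mul_assoc A B C := Subtype.ext (Matrix.mul_assoc _ _ _)
  one_mul A := Subtype.ext (Matrix.one_mul _)
  mul_one A := Subtype.ext (Matrix.mul_one _)
  inv_mul_cancel A := Subtype.ext A.2.1

/-- The product in `SO(3)` is the matrix product. [folklore] -/
@[simp] theorem coe_mul (A B : SO3) : (A * B).1 = A.1 * B.1 := rfl

/-- The unit of `SO(3)` is the unit matrix. [folklore] -/
@[simp] theorem coe_one : (1 : SO3).1 = 1 := rfl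

/-- The inverse in `SO(3)` is the transpose. [folklore] -/
@[simp] theorem coe_inv (A : SO3) : A⁻¹.1 = A.1ᵀ := rfl

/-- Entries of `Mᵀ M = 1`: the columns of `M ∈ SO(3)` are orthonormal. [folklore] -/
theorem sum_mul_eq (A : SO3) (i j : Fin 3) :
    A.1 0 i * A.1 0 j + A.1 1 i * A.1 1 j + A.1 2 i * A.1 2 j = if i = j then 1 else 0 := by
  have h := congrFun (congrFun A.2.1 i) j
  simpa [Matrix.mul_apply, Fin.sum_univ_three, Matrix.one_apply] using h

/-- Entries of `M Mᵀ = 1`: the rows of `M ∈ SO(3)` are orthonormal. [folklore] -/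
theorem sum_mul_eq' (A : SO3) (i j : Fin 3) :
    A.1 i 0 * A.1 j 0 + A.1 i 1 * A.1 j 1 + A.1 i 2 * A.1 j 2 = if i = j then 1 else 0 := by
  have h := congrFun (congrFun A.mul_transpose_self i) j
  simpa [Matrix.mul_apply, Fin.sum_univ_three, Matrix.one_apply] using h

end SO3

/-! ### The rotation matrix of a quaternion -/

section QuatRot

open Quaternion

/-- **The rotation matrix of a quaternion** `q = a + b i + c j + d k`: the matrix of the real-linear
map `v ↦ q v q̄` of `Im ℍ = ℝ i ⊕ ℝ j ⊕ ℝ k` in the basis `(i, j, k)` (for `|q| = 1` a rotation;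
in general `|q|²` times one). [cite: HatcherAT2002, §3.D (the homomorphism S³ → SO(3), u ↦ (w ↦ u w u⁻¹))] -/
def quatRot (q : ℍ) : Matrix (Fin 3) (Fin 3) ℝ :=
  !![q.re ^ 2 + q.imI ^ 2 - q.imJ ^ 2 - q.imK ^ 2, 2 * (q.imI * q.imJ - q.re * q.imK),
      2 * (q.imI * q.imK + q.re * q.imJ);
    2 * (q.imI * q.imJ + q.re * q.imK), q.re ^ 2 - q.imI ^ 2 + q.imJ ^ 2 - q.imK ^ 2,
      2 * (q.imJ * q.imK - q.re * q.imI);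
    2 * (q.imI * q.imK - q.re * q.imJ), 2 * (q.imJ * q.imK + q.re * q.imI),
      q.re ^ 2 - q.imI ^ 2 - q.imJ ^ 2 + q.imK ^ 2]

/-- `quatRot 1 = 1`. [folklore] -/
@[simp] theorem quatRot_one : quatRot 1 = 1 := by
  ext i j
  fin_cases i <;> fin_cases j <;> simp [quatRot]

/-- `quatRot (-q) = quatRot q` (the kernel `{±1}`). [cite: HatcherAT2002, §3.D (kernel ℤ₂ = {±1})] -/
@[simp] theorem quatRot_neg (q : ℍ) : quatRot (-q) = quatRot q := by
  ext i j
  fin_cases i <;> fin_cases j <;> simp [quatRot]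

/-- **`q ↦ quatRot q` is multiplicative** (it is the matrix of the representation
`q ↦ (v ↦ q v q̄)`). [cite: HatcherAT2002, §3.D (the homomorphism S³ → SO(3))] -/
theorem quatRot_mul (p q : ℍ) : quatRot (p * q) = quatRot p * quatRot q := by
  ext i j
  fin_cases i <;> fin_cases j <;>
    simp [quatRot, Matrix.mul_apply, Fin.sum_univ_three] <;> ring

/-- **The columns of `quatRot q` are orthogonal of length `|q|²`**:
`(quatRot q)ᵀ quatRot q = |q|⁴ · 1`. [cite: HatcherAT2002, §3.D (quaternion multiplication by a unit is an isometry)] -/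
theorem transpose_quatRot_mul_self (q : ℍ) :
    (quatRot q)ᵀ * quatRot q = (normSq q ^ 2) • (1 : Matrix (Fin 3) (Fin 3) ℝ) := by
  ext i j
  fin_cases i <;> fin_cases j <;>
    simp [quatRot, Matrix.mul_apply, Fin.sum_univ_three, normSq_def'] <;> ring

/-- `det (quatRot q) = |q|⁶`. [folklore] -/
theorem det_quatRot (q : ℍ) : (quatRot q).det = normSq q ^ 3 := by
  simp only [quatRot, Matrix.det_fin_three, normSq_def']
  simp
  ring

/-- `quatRot` is continuous (polynomial entries). [folklore] -/
theorem continuous_quatRot : Continuous quatRot := by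
  refine continuous_matrix fun i j ↦ ?_
  have h1 := continuous_re
  have h2 := continuous_imI
  have h3 := continuous_imJ
  have h4 := continuous_imK
  fin_cases i <;> fin_cases j <;> simp [quatRot] <;> fun_prop

/-- **Kernel**: `quatRot q = 1` with `|q| = 1` forces `q = ±1` (the diagonal gives
`4 re(q)² = 4`). [cite: HatcherAT2002, §3.D (kernel ℤ₂ = {±1})] -/
theorem eq_one_or_eq_neg_one_of_quatRot_eq_one {q : ℍ} (hq : normSq q = 1) (h : quatRot q = 1) :
    q = 1 ∨ q = -1 := by
  have h00 := congrFun (congrFun h 0) 0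
  have h11 := congrFun (congrFun h 1) 1
  have h22 := congrFun (congrFun h 2) 2
  simp [quatRot] at h00 h11 h22
  rw [normSq_def'] at hq
  have hI : q.imI = 0 := by nlinarith [sq_nonneg q.imI, sq_nonneg q.imJ, sq_nonneg q.imK]
  have hJ : q.imJ = 0 := by nlinarith [sq_nonneg q.imI, sq_nonneg q.imJ, sq_nonneg q.imK]
  have hK : q.imK = 0 := by nlinarith [sq_nonneg q.imI, sq_nonneg q.imJ, sq_nonneg q.imK]
  have hre : q.re ^ 2 = 1 := by
    simp only [hI, hJ, hK] at hq
    nlinarith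
  have hre' : q.re = 1 ∨ q.re = -1 := mul_self_eq_one_iff.mp (by nlinarith [hre])
  rcases hre' with hre1 | hre1
  · left; ext <;> simp [hI, hJ, hK, hre1]
  · right; ext <;> simp [hI, hJ, hK, hre1]

end QuatRot

/-! ### The homomorphism `S³ → SO(3)` -/

section RotHom

open Quaternion

/-- Unit quaternions have `normSq = 1`. [folklore] -/
theorem normSq_coe_sphere (q : Metric.sphere (0 : ℍ) 1) : normSq (q : ℍ) = 1 := by
  rw [normSq_eq_norm_mul_self, norm_eq_of_mem_sphere q, mul_one]

/-- **The universal covering homomorphism `S³ → SO(3)`**, `q ↦ (v ↦ q v q̄)` on unit quaternions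
(Hatcher, §3.D). [cite: HatcherAT2002, §3.D (the homomorphism S³ → SO(3))] -/
def rotHom : Metric.sphere (0 : ℍ) 1 →* SO3 where
  toFun q := ⟨quatRot q, by
      rw [transpose_quatRot_mul_self, normSq_coe_sphere, one_pow, one_smul],
    by rw [det_quatRot, normSq_coe_sphere, one_pow]⟩
  map_one' := Subtype.ext (by simp [Metric.unitSphere.coe_one])
  map_mul' p q := Subtype.ext (by simp [Metric.unitSphere.coe_mul, quatRot_mul])

/-- The matrix of `rotHom q` is `quatRot q`. [folklore] -/
@[simp] theorem coe_rotHom (q : Metric.sphere (0 : ℍ) 1) : (rotHom q).1 = quatRot q := rfl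

/-- `rotHom` is continuous. [folklore] -/
theorem continuous_rotHom : Continuous rotHom :=
  (continuous_quatRot.comp continuous_subtype_val).subtype_mk _

/-- **The kernel of `S³ → SO(3)` is `{±1}`.** [cite: HatcherAT2002, §3.D (kernel ℤ₂ = {±1})] -/
theorem mem_ker_rotHom_iff (q : Metric.sphere (0 : ℍ) 1) : q ∈ rotHom.ker ↔ q = 1 ∨ q = -1 := by
  rw [MonoidHom.mem_ker]
  constructor
  · intro h
    have h' : quatRot q = 1 := congrArg Subtype.val h
    rcases eq_one_or_eq_neg_one_of_quatRot_eq_one (normSq_coe_sphere q) h' with h1 | h1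
    · left; exact Subtype.ext (by simpa [Metric.unitSphere.coe_one] using h1)
    · right; exact Subtype.ext (by simpa [Metric.unitSphere.coe_one] using h1)
  · rintro (rfl | rfl)
    · exact map_one rotHom
    · apply Subtype.ext
      show quatRot ((-1 : Metric.sphere (0 : ℍ) 1) : ℍ) = 1
      rw [show ((-1 : Metric.sphere (0 : ℍ) 1) : ℍ) = -1 by simp [Metric.unitSphere.coe_one],
        quatRot_neg, quatRot_one]

/-- `1 ≠ -1` in `S³`. [folklore] -/
theorem one_ne_neg_one_sphere : (1 : Metric.sphere (0 : ℍ) 1) ≠ -1 := by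
  intro h
  have h' := congrArg (fun q : Metric.sphere (0 : ℍ) 1 ↦ (q : ℍ).re) h
  simp [Metric.unitSphere.coe_one] at h'
  norm_num at h'

/-- The kernel as a set is `{1, -1}`. [cite: HatcherAT2002, §3.D (kernel ℤ₂ = {±1})] -/
theorem coe_ker_rotHom : (rotHom.ker : Set (Metric.sphere (0 : ℍ) 1)) = {1, -1} := by
  ext q
  rw [SetLike.mem_coe, mem_ker_rotHom_iff]
  simp

/-- **The kernel `{±1}` has two elements.** [cite: HatcherAT2002, §3.D (kernel ℤ₂ = {±1})] -/
theorem card_ker_rotHom : Nat.card rotHom.ker = 2 := by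
  rw [Nat.card_eq_two_iff' (1 : rotHom.ker)]
  refine ⟨⟨-1, (mem_ker_rotHom_iff _).2 (Or.inr rfl)⟩, ?_, ?_⟩
  · intro h
    exact one_ne_neg_one_sphere (congrArg Subtype.val h).symm
  · rintro ⟨q, hq⟩ hne
    rcases (mem_ker_rotHom_iff q).1 hq with rfl | rfl
    · exact absurd rfl hne
    · rfl

/-- The kernel is a discrete subset (it is finite). [folklore] -/
theorem isDiscrete_ker_rotHom : IsDiscrete (rotHom.ker : Set (Metric.sphere (0 : ℍ) 1)) := by
  rw [coe_ker_rotHom]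
  exact (Set.toFinite _).isDiscrete

/-! #### Surjectivity: coordinate-axis rotations and Givens elimination -/

/-- **Half-angle formulas**: every point `(c, s)` of the unit circle is `(α² - β², 2αβ)` for a point
`(α, β)` of the unit circle (`α = cos(θ/2)`, `β = sin(θ/2)`). [folklore] -/
theorem exists_half_angle {c s : ℝ} (h : c ^ 2 + s ^ 2 = 1) :
    ∃ α β : ℝ, α ^ 2 + β ^ 2 = 1 ∧ α ^ 2 - β ^ 2 = c ∧ 2 * (α * β) = s := by
  have hc1 : c ≤ 1 := by nlinarith [sq_nonneg s]
  have hc2 : -1 ≤ c := by nlinarith [sq_nonneg s]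
  have hα : Real.sqrt ((1 + c) / 2) ^ 2 = (1 + c) / 2 := Real.sq_sqrt (by linarith)
  have hβ : Real.sqrt ((1 - c) / 2) ^ 2 = (1 - c) / 2 := Real.sq_sqrt (by linarith)
  have hprod : 2 * (Real.sqrt ((1 + c) / 2) * Real.sqrt ((1 - c) / 2)) = |s| := by
    rw [← Real.sqrt_mul (by linarith), show (1 + c) / 2 * ((1 - c) / 2) = (s / 2) ^ 2 by nlinarith,
      Real.sqrt_sq_eq_abs, abs_div, abs_two]
    ring
  rcases le_or_gt 0 s with hs | hs
  · refine ⟨Real.sqrt ((1 + c) / 2), Real.sqrt ((1 - c) / 2), by rw [hα, hβ]; ring,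
      by rw [hα, hβ]; ring, by rw [hprod, abs_of_nonneg hs]⟩
  · refine ⟨Real.sqrt ((1 + c) / 2), -Real.sqrt ((1 - c) / 2), by rw [neg_sq, hα, hβ]; ring,
      by rw [neg_sq, hα, hβ]; ring, ?_⟩
    rw [mul_neg, mul_neg, hprod, abs_of_neg hs, neg_neg]

/-- The point `(α, β, 0, 0)`-type quaternion `α + β u` for a coordinate axis `u` is a unit quaternion
when `α² + β² = 1`. [folklore] -/
theorem mem_sphere_of_sq_add_sq {α β : ℝ} (h : α ^ 2 + β ^ 2 = 1) (q : ℍ)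
    (hq : normSq q = α ^ 2 + β ^ 2) : q ∈ Metric.sphere (0 : ℍ) 1 := by
  rw [mem_sphere_zero_iff_norm, ← Real.sqrt_mul_self (norm_nonneg _), ← normSq_eq_norm_mul_self,
    hq, h, Real.sqrt_one]

/-- The rotation about the first axis with cosine `c` and sine `s`. [folklore] -/
def rotX (c s : ℝ) : Matrix (Fin 3) (Fin 3) ℝ := !![1, 0, 0; 0, c, -s; 0, s, c]

/-- The rotation about the second axis with cosine `c` and sine `s`. [folklore] -/
def rotY (c s : ℝ) : Matrix (Fin 3) (Fin 3) ℝ := !![c, 0, s; 0, 1, 0; -s, 0, c]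

/-- The rotation about the third axis with cosine `c` and sine `s`. [folklore] -/
def rotZ (c s : ℝ) : Matrix (Fin 3) (Fin 3) ℝ := !![c, -s, 0; s, c, 0; 0, 0, 1]

/-- **Coordinate rotations about the first axis are images of unit quaternions `α + β i`.** [cite: HatcherAT2002, §3.D (φ sends x to the rotation through angle |x|π about the axis x)] -/
theorem rotX_mem_range (c s : ℝ) (h : c ^ 2 + s ^ 2 = 1) :
    ∃ q : Metric.sphere (0 : ℍ) 1, (rotHom q).1 = rotX c s := by
  obtain ⟨α, β, h1, h2, h3⟩ := exists_half_angle h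
  refine ⟨⟨⟨α, β, 0, 0⟩, mem_sphere_of_sq_add_sq h1 _ (by simp [normSq_def'])⟩, ?_⟩
  rw [coe_rotHom]
  ext i j
  fin_cases i <;> fin_cases j <;> simp [quatRot, rotX, ← h2, ← h3, h1]

/-- Coordinate rotations about the second axis are images of unit quaternions `α + β j`. [cite: HatcherAT2002, §3.D (φ sends x to the rotation through angle |x|π about the axis x)] -/
theorem rotY_mem_range (c s : ℝ) (h : c ^ 2 + s ^ 2 = 1) :
    ∃ q : Metric.sphere (0 : ℍ) 1, (rotHom q).1 = rotY c s := by
  obtain ⟨α, β, h1, h2, h3⟩ := exists_half_angle h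
  refine ⟨⟨⟨α, 0, β, 0⟩, mem_sphere_of_sq_add_sq h1 _ (by simp [normSq_def'])⟩, ?_⟩
  rw [coe_rotHom]
  ext i j
  fin_cases i <;> fin_cases j <;> simp [quatRot, rotY, ← h2, ← h3, h1]

/-- Coordinate rotations about the third axis are images of unit quaternions `α + β k`. [cite: HatcherAT2002, §3.D (φ sends x to the rotation through angle |x|π about the axis x)] -/
theorem rotZ_mem_range (c s : ℝ) (h : c ^ 2 + s ^ 2 = 1) :
    ∃ q : Metric.sphere (0 : ℍ) 1, (rotHom q).1 = rotZ c s := by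
  obtain ⟨α, β, h1, h2, h3⟩ := exists_half_angle h
  refine ⟨⟨⟨α, 0, 0, β⟩, mem_sphere_of_sq_add_sq h1 _ (by simp [normSq_def'])⟩, ?_⟩
  rw [coe_rotHom]
  ext i j
  fin_cases i <;> fin_cases j <;> simp [quatRot, rotZ, ← h2, ← h3, h1]

/-- **An element of `SO(3)` fixing the first basis vector is a rotation about the first axis.**
If the first column of `N ∈ SO(3)` is `e₁`, orthonormality of rows and columns forces the first
row to be `e₁` and the remaining block to lie in `SO(2)`, i.e. `N = rotX p r` with
`p = N₁₁`, `r = N₂₁`. [folklore] -/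
theorem eq_rotX_of_apply_zero (N : SO3) (h0 : N.1 0 0 = 1) (h1 : N.1 1 0 = 0) (h2 : N.1 2 0 = 0) :
    N.1 = rotX (N.1 1 1) (N.1 2 1) ∧ N.1 1 1 ^ 2 + N.1 2 1 ^ 2 = 1 := by
  -- first row is `e₁`
  have r0 := N.sum_mul_eq' 0 0
  simp only [if_true] at r0
  rw [h0] at r0
  have h01 : N.1 0 1 = 0 := by nlinarith [sq_nonneg (N.1 0 1), sq_nonneg (N.1 0 2)]
  have h02 : N.1 0 2 = 0 := by nlinarith [sq_nonneg (N.1 0 1), sq_nonneg (N.1 0 2)]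
  -- the lower block: columns orthonormal, determinant one
  have c11 := N.sum_mul_eq 1 1
  have c22 := N.sum_mul_eq 2 2
  have c12 := N.sum_mul_eq 1 2
  simp only [if_true, Fin.isValue, show ((1 : Fin 3) = 2) = False by decide, if_false] at c11 c22 c12
  rw [h01] at c11 c12
  rw [h02] at c22 c12
  have hdet := N.2.2
  rw [Matrix.det_fin_three, h0, h1, h2, h01, h02] at hdet
  have hpr : N.1 1 1 ^ 2 + N.1 2 1 ^ 2 = 1 := by nlinarith
  have hqt : N.1 1 2 ^ 2 + N.1 2 2 ^ 2 = 1 := by nlinarith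
  have hsum : (N.1 1 2 + N.1 2 1) ^ 2 + (N.1 2 2 - N.1 1 1) ^ 2 = 0 := by nlinarith
  have hq : N.1 1 2 = -N.1 2 1 := by
    nlinarith [sq_nonneg (N.1 1 2 + N.1 2 1), sq_nonneg (N.1 2 2 - N.1 1 1)]
  have ht : N.1 2 2 = N.1 1 1 := by
    nlinarith [sq_nonneg (N.1 1 2 + N.1 2 1), sq_nonneg (N.1 2 2 - N.1 1 1)]
  refine ⟨?_, hpr⟩
  ext i j
  fin_cases i <;> fin_cases j <;> simp [rotX, h0, h1, h2, h01, h02, hq, ht]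

/-- **`S³ → SO(3)` is surjective**: rotate the first column of `M ∈ SO(3)` to `e₁` by a rotation
about the third axis followed by one about the second axis (Givens elimination); what remains fixes
`e₁`, hence is a rotation about the first axis; all three are images of unit quaternions and the
image is a subgroup. [cite: HatcherAT2002, §3.D (φ̄ : ℝP³ → SO(3) is surjective: each nonidentity element of SO(3) is a rotation about some axis)] -/
theorem surjective_rotHom : Surjective rotHom := by
  intro M
  -- the image is a subgroup containing the coordinate rotations
  have himage : ∀ {A B : SO3}, A ∈ Set.range rotHom → B ∈ Set.range rotHom → A * B ∈ Set.range rotHom := by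
    rintro A B ⟨a, rfl⟩ ⟨b, rfl⟩
    exact ⟨a * b, map_mul rotHom a b⟩
  have hinv : ∀ {A : SO3}, A ∈ Set.range rotHom → A⁻¹ ∈ Set.range rotHom := by
    rintro A ⟨a, rfl⟩
    exact ⟨a⁻¹, map_inv rotHom a⟩
  -- Step 1: a product `G` of coordinate rotations with `(G M) e₁ = e₁`
  set x := M.1 0 0
  set y := M.1 1 0
  set z := M.1 2 0
  have hcol : x ^ 2 + y ^ 2 + z ^ 2 = 1 := by
    have := M.sum_mul_eq 0 0
    simp only [if_true] at this
    nlinarith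
  obtain ⟨G, hG, hG0, hG1, hG2⟩ : ∃ G : SO3, G ∈ Set.range rotHom ∧
      (G * M).1 0 0 = 1 ∧ (G * M).1 1 0 = 0 ∧ (G * M).1 2 0 = 0 := by
    by_cases hρ : x ^ 2 + y ^ 2 = 0
    · -- first column is `± e₃`: one rotation about the second axis
      have hx : x = 0 := by nlinarith [sq_nonneg x, sq_nonneg y]
      have hy : y = 0 := by nlinarith [sq_nonneg x, sq_nonneg y]
      have hz : z ^ 2 = 1 := by nlinarith
      obtain ⟨q, hq⟩ := rotY_mem_range 0 z (by rw [hz]; ring)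
      refine ⟨rotHom q, ⟨q, rfl⟩, ?_, ?_, ?_⟩ <;>
        simp only [SO3.coe_mul, hq, rotY, Matrix.mul_apply, Fin.sum_univ_three] <;>
        simp [show M.1 0 0 = x from rfl, show M.1 1 0 = y from rfl, show M.1 2 0 = z from rfl, hx, hy]
      nlinarith
    · -- general case: rotate about the third axis to kill `y`, then about the second to kill `z`
      have hρpos : 0 < x ^ 2 + y ^ 2 := lt_of_le_of_ne (by positivity) (Ne.symm hρ)
      set ρ := Real.sqrt (x ^ 2 + y ^ 2) with hρdef
      have hρ2 : ρ ^ 2 = x ^ 2 + y ^ 2 := Real.sq_sqrt hρpos.le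
      have hρpos' : 0 < ρ := Real.sqrt_pos.2 hρpos
      have hρne : ρ ≠ 0 := hρpos'.ne'
      obtain ⟨q₁, hq₁⟩ := rotZ_mem_range (x / ρ) (-(y / ρ)) (by
        field_simp; nlinarith)
      obtain ⟨q₂, hq₂⟩ := rotY_mem_range ρ z (by nlinarith)
      refine ⟨rotHom q₂ * rotHom q₁, himage ⟨q₂, rfl⟩ ⟨q₁, rfl⟩, ?_, ?_, ?_⟩ <;>
        simp only [SO3.coe_mul, hq₁, hq₂, rotY, rotZ, Matrix.mul_apply, Fin.sum_univ_three] <;>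
        simp [show M.1 0 0 = x from rfl, show M.1 1 0 = y from rfl, show M.1 2 0 = z from rfl] <;>
        field_simp
      · nlinarith [hρ2]
      · ring
      · linear_combination z * hρ2
  -- Step 2: `G M` is a rotation about the first axis
  obtain ⟨hN, hpr⟩ := eq_rotX_of_apply_zero (G * M) hG0 hG1 hG2
  obtain ⟨q₃, hq₃⟩ := rotX_mem_range _ _ hpr
  have hGM : G * M ∈ Set.range rotHom := ⟨q₃, Subtype.ext (hq₃.trans hN.symm)⟩
  -- conclude: `M = G⁻¹ (G M)`
  have : M = G⁻¹ * (G * M) := by group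
  rw [this]
  exact himage (hinv hG) hGM

/-! #### The covering `S³ → SO(3)` and `π₁(SO(3)) = ℤ/2` -/

/-- `S³ → SO(3)` is a quotient map (a continuous surjection from a compact space to a Hausdorff
space). [folklore] -/
theorem isQuotientMap_rotHom : IsQuotientMap rotHom :=
  continuous_rotHom.isClosedMap.isQuotientMap continuous_rotHom surjective_rotHom

/-- **`S³ → SO(3)` is a covering map**, indeed a quotient covering map for the kernel `{±1}`
acting by translation (a quotient homomorphism of a topological group with discrete kernel). [cite: HatcherAT2002, §3.D (the universal cover S³ → SO(3))] -/
theorem isQuotientCoveringMap_rotHom : IsQuotientCoveringMap rotHom rotHom.ker :=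
  isQuotientMap_rotHom.isQuotientCoveringMap_of_isDiscrete_ker_monoidHom isDiscrete_ker_rotHom

/-- `S³ → SO(3)` is a covering map. [cite: HatcherAT2002, §3.D (the universal cover S³ → SO(3))] -/
theorem isCoveringMap_rotHom : IsCoveringMap rotHom := isQuotientCoveringMap_rotHom.isCoveringMap

/-- **`S³` is simply connected** (Hatcher, Prop. 1.14, for the unit sphere of `ℍ ≅ ℝ⁴`;
`SphereSimplyConnected.lean`). [cite: HatcherAT2002, Prop. 1.14] -/
instance simplyConnectedSpace_sphere_quaternion : SimplyConnectedSpace (Metric.sphere (0 : ℍ) 1) :=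
  haveI : Fact (Module.finrank ℝ ℍ = 3 + 1) := ⟨by rw [Quaternion.finrank_eq_four]⟩
  FundamentalGroup.simplyConnectedSpace_sphere (E := ℍ) (n := 3) (by norm_num)

/-- **`π₁(SO(3)) ≅ ℤ/2`: the fundamental group of `SO(3)` at `1` has exactly two elements** — the
fundamental group of the base of the simply connected covering `S³ → SO(3)` is (anti-)isomorphic to
its group `{±1}` of deck translations (Hatcher, Prop. 1.39/1.40 with §3.D; Mathlib's
`IsQuotientCoveringMap.fundamentalGroupEquiv`). [cite: HatcherAT2002, §3.D (SO(3) ≈ ℝP³, universal cover S³ → SO(3)) and Prop. 1.40 (π₁ of an orbit space)] -/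
theorem SO3.card_fundamentalGroup : Nat.card (FundamentalGroup SO3 1) = 2 := by
  let e : rotHom ⁻¹' {(1 : SO3)} := ⟨1, map_one rotHom⟩
  have h := Nat.card_congr (isQuotientCoveringMap_rotHom.fundamentalGroupEquiv e).toEquiv
  rw [h, Nat.card_congr (MulOpposite.opEquiv : rotHom.ker ≃ (rotHom.ker)ᵐᵒᵖ).symm, card_ker_rotHom]

end RotHom

end Literature.AlgebraicTopology.FundamentalGroup
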